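import Mathlib
import Summits.Ventures.PercRepro2.A3FibreMark
import Summits.Ventures.PercRepro2.PendantO
import Summits.Ventures.PercRepro2.LeafStepT0

/-!
# The a₃-exploration fibres at a leaf `a₃` attached to `o`: support, collapsed ratio sums, masses
(blind cell PercRepro2, night-1 g30; proofs/NIGHT1-G30.md §6; the assembly is A3PendantO.lean)

Let `a₃` be a leaf attached to `o` by the edge `f` of weight `q = p f`.  The fibres of the
`a₃`-exploration are `{a₃}` (`f` closed; `fibre_singleton_leaf`: the fibre is `Q ∩ {f closed}`) and the
sets containing `a₃` and `o` (`f` open); every other fibre is null (`fibre_eq_empty_of_leaf`,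
`mW_eq_zero_of_leaf`).  On a fibre containing `o` the mass of `F` is `γ · s3 · m_W` (A3FibreMark), so
the two ratio sums of `btw` collapse to the fibre `{a₃}` plus `γ · E_Q[σ_b σ₃]` (`sum_Ssig_SF_div_leaf`,
`sum_Su_Su_div_leaf`), and the `{a₃}`-fibre masses and the `a₃`-moments are `o`-marked masses times
`1 − q` resp. `q` (`mW_singleton_leaf`, `Ssig_singleton_leaf`, `Su_singleton_leaf`, `EQb3_leaf`,
`EQ3_leaf`, `EQ3o_leaf`, `Do_leaf`, `PDb_leaf`; PendantO's `prob_*_o` for the events).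
Standard axioms.
-/

namespace Summit.Ventures.PercRepro2

open UnionCluster CovForm PendantRoot PendantO

namespace CovForm

namespace A3Fibre

section LeafFibres

variable {V : Type*} {E : Type*} [Fintype V] [DecidableEq V] [Fintype E] [DecidableEq E]
  {ends : E → Sym2 V} {f : E} {a₃ o : V}

omit [Fintype V] [DecidableEq V] [Fintype E] [DecidableEq E] in
/-- With `f` closed the cluster of the leaf is `{a₃}`. -/
lemma cluster_leaf_closed (hf : ends f = s(a₃, o)) (hleaf : ∀ e, a₃ ∈ ends e → e = f)
    (h3o : a₃ ≠ o) {ω : Config E} (hωf : ω f = false) :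
    cluster ends ω a₃ = (↑({a₃} : Finset V) : Set V) := by
  ext u
  simp only [cluster, Set.mem_setOf_eq, Finset.coe_singleton, Set.mem_singleton_iff]
  constructor
  · intro h; exact (conn_leaf_closed hf hleaf h3o hωf h)
  · intro hu; rw [hu]; exact conn_refl ends ω a₃

omit [Fintype V] [DecidableEq V] [Fintype E] [DecidableEq E] in
/-- With `f` open the cluster of the leaf is the cluster of `o`, which contains `o`. -/
lemma mem_cluster_leaf_open (hf : ends f = s(a₃, o)) {ω : Config E} (hωf : ω f = true) :
    o ∈ cluster ends ω a₃ :=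
  conn_of_openAdj ⟨f, hωf, hf⟩

omit [Fintype V] [DecidableEq V] [Fintype E] [DecidableEq E] in
/-- **The fibre `{a₃}` is `Q ∩ {f closed}`.** -/
lemma fibre_singleton_leaf (hf : ends f = s(a₃, o)) (hleaf : ∀ e, a₃ ∈ ends e → e = f)
    (h3o : a₃ ≠ o) (a₁ a₂ : V) :
    fibre ends a₁ a₂ a₃ {a₃} = avoidAll ends a₂ {a₁} ∩ closedEdge f := by
  ext ω
  simp only [fibre, Set.mem_inter_iff, mem_clusterEvent, closedEdge, Set.mem_setOf_eq]
  constructor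
  · rintro ⟨hQ, hc⟩
    refine ⟨hQ, ?_⟩
    cases h : ω f
    · rfl
    · exfalso
      have ho : o ∈ cluster ends ω a₃ := mem_cluster_leaf_open hf h
      rw [hc] at ho
      simp only [Finset.coe_singleton, Set.mem_singleton_iff] at ho
      exact h3o ho.symm
  · rintro ⟨hQ, hωf⟩
    exact ⟨hQ, cluster_leaf_closed hf hleaf h3o hωf⟩

omit [Fintype V] [DecidableEq V] [Fintype E] [DecidableEq E] in
/-- **A fibre other than `{a₃}` that does not contain `o` is empty.** -/
lemma fibre_eq_empty_of_leaf (hf : ends f = s(a₃, o)) (hleaf : ∀ e, a₃ ∈ ends e → e = f)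
    (h3o : a₃ ≠ o) (a₁ a₂ : V) {W : Finset V} (hW : W ≠ {a₃}) (hoW : o ∉ W) :
    fibre ends a₁ a₂ a₃ W = ∅ := by
  ext ω
  simp only [fibre, Set.mem_inter_iff, mem_clusterEvent, Set.mem_empty_iff_false, iff_false,
    not_and]
  intro _ hc
  cases h : ω f
  · apply hW
    apply Finset.coe_injective
    rw [← hc, cluster_leaf_closed hf hleaf h3o h]
  · apply hoW
    have ho : o ∈ cluster ends ω a₃ := mem_cluster_leaf_open hf h
    rw [hc] at ho
    exact Finset.mem_coe.1 ho

variable {R : Type*} [CommRing R]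

omit [Fintype V] [DecidableEq V] in
/-- The mass of a fibre other than `{a₃}` not containing `o` vanishes. -/
lemma mW_eq_zero_of_leaf (p : E → R) (hf : ends f = s(a₃, o)) (hleaf : ∀ e, a₃ ∈ ends e → e = f)
    (h3o : a₃ ≠ o) (a₁ a₂ : V) {W : Finset V} (hW : W ≠ {a₃}) (hoW : o ∉ W) :
    mW p ends a₁ a₂ a₃ W = 0 := by
  unfold mW
  rw [fibre_eq_empty_of_leaf hf hleaf h3o a₁ a₂ hW hoW, prob_empty]

omit [Fintype V] [Fintype E] [DecidableEq E] in
/-- `s3 {a₃} = 0` when neither root is the leaf. -/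
lemma s3_singleton (a₁ a₂ : V) (h31 : a₃ ≠ a₁) (h32 : a₃ ≠ a₂) :
    (s3 a₁ a₂ ({a₃} : Finset V) : R) = 0 := by
  unfold s3
  simp [Finset.mem_singleton, Ne.symm h31, Ne.symm h32]

end LeafFibres


section LeafSums

variable {V : Type*} {E : Type*} [Fintype V] [DecidableEq V] [Fintype E] [DecidableEq E]
  {R : Type*} [Field R] [LinearOrder R] [IsStrictOrderedRing R]
  {ends : E → Sym2 V} {f : E} {a₃ o : V}

/-- **The first ratio sum of `btw` collapses at a leaf**: only the fibre `{a₃}` keeps its ratio; on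
every other non-null fibre `SF = γ · s3 · m_W` cancels the denominator. -/
lemma sum_Ssig_SF_div_leaf {p : E → R} (hp : IsProbVec p) (hf : ends f = s(a₃, o))
    (hleaf : ∀ e, a₃ ∈ ends e → e = f) (h3o : a₃ ≠ o) {a₁ a₂ : V} (h31 : a₃ ≠ a₁) (h32 : a₃ ≠ a₂)
    (b : V) :
    ∑ W : Finset V, Ssig p ends a₁ a₂ a₃ b W * SF p ends o a₁ a₂ a₃ W / mW p ends a₁ a₂ a₃ W =
      Ssig p ends a₁ a₂ a₃ b {a₃} * SF p ends o a₁ a₂ a₃ {a₃} / mW p ends a₁ a₂ a₃ {a₃} +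
        gamma p ends o a₁ a₂ a₃ * ∑ W : Finset V, s3 a₁ a₂ W * Ssig p ends a₁ a₂ a₃ b W := by
  have key : ∀ W : Finset V,
      Ssig p ends a₁ a₂ a₃ b W * SF p ends o a₁ a₂ a₃ W / mW p ends a₁ a₂ a₃ W =
        gamma p ends o a₁ a₂ a₃ * (s3 a₁ a₂ W * Ssig p ends a₁ a₂ a₃ b W) +
          (if W = {a₃} then
            Ssig p ends a₁ a₂ a₃ b {a₃} * SF p ends o a₁ a₂ a₃ {a₃} / mW p ends a₁ a₂ a₃ {a₃} -
              gamma p ends o a₁ a₂ a₃ * (s3 a₁ a₂ {a₃} * Ssig p ends a₁ a₂ a₃ b {a₃})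
          else 0) := by
    intro W
    by_cases hW : W = {a₃}
    · subst hW
      simp only [if_true]
      ring
    · rw [if_neg hW, add_zero]
      by_cases ho : o ∈ W
      · rw [SF_eq_of_mem p ends o a₁ a₂ a₃ W ho]
        by_cases hm : mW p ends a₁ a₂ a₃ W = 0
        · rw [hm, Ssig_eq_zero_of_mW_eq_zero hp ends a₁ a₂ a₃ b W hm]
          ring
        · field_simp
      · have hm := mW_eq_zero_of_leaf p hf hleaf h3o a₁ a₂ hW ho
        rw [hm, Ssig_eq_zero_of_mW_eq_zero hp ends a₁ a₂ a₃ b W hm]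
        ring
  rw [Finset.sum_congr rfl (fun W _ => key W)]
  rw [Finset.sum_add_distrib, Finset.sum_ite_eq', if_pos (Finset.mem_univ _), ← Finset.mul_sum,
    s3_singleton (R := R) a₁ a₂ h31 h32]
  ring

/-- **The `A`-ratio sum of `btw` collapses at a leaf** to the fibre `{a₃}`: on every other `A`-fibre
either `o ∈ W` (so `U_o = 0` there) or the fibre is null. -/
lemma sum_Su_Su_div_leaf {p : E → R} (hp : IsProbVec p) (hf : ends f = s(a₃, o))
    (hleaf : ∀ e, a₃ ∈ ends e → e = f) (h3o : a₃ ≠ o) {a₁ a₂ : V} (h31 : a₃ ≠ a₁) (h32 : a₃ ≠ a₂)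
    (b : V) :
    ∑ W ∈ fibresA a₁ a₂, Su p ends a₁ a₂ a₃ b W * Su p ends a₁ a₂ a₃ o W / mW p ends a₁ a₂ a₃ W =
      Su p ends a₁ a₂ a₃ b {a₃} * Su p ends a₁ a₂ a₃ o {a₃} / mW p ends a₁ a₂ a₃ {a₃} := by
  apply Finset.sum_eq_single
  · intro W hWA hW
    rw [fibresA, Finset.mem_filter] at hWA
    by_cases ho : o ∈ W
    · rw [Su_eq_of_mem p ends a₁ a₂ a₃ o W ho]
      have hs : (s3 a₁ a₂ W : R) = 0 := by
        unfold s3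
        simp [hWA.2.1, hWA.2.2]
      rw [hs]
      ring
    · have hm := mW_eq_zero_of_leaf p hf hleaf h3o a₁ a₂ hW ho
      rw [hm, Su_eq_zero_of_mW_eq_zero hp ends a₁ a₂ a₃ b W hm]
      ring
  · intro h
    exfalso
    apply h
    rw [fibresA, Finset.mem_filter]
    exact ⟨Finset.mem_univ _, by simp [Finset.mem_singleton, Ne.symm h31, Ne.symm h32]⟩

end LeafSums


section LeafMasses

variable {V : Type*} {E : Type*} [Fintype E] [DecidableEq E] {R : Type*} [Field R]
  {ends : E → Sym2 V} {f : E} {a₃ o : V} (p : E → R)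

/-- `m_{a₃} = (1 − q) P(Q)`. -/
lemma mW_singleton_leaf (hf : ends f = s(a₃, o)) (hleaf : ∀ e, a₃ ∈ ends e → e = f)
    (h3o : a₃ ≠ o) {a₁ a₂ : V} (h31 : a₃ ≠ a₁) (h32 : a₃ ≠ a₂) :
    mW p ends a₁ a₂ a₃ {a₃} = prob p (avoidAll ends a₂ {a₁}) * (1 - p f) := by
  unfold mW
  rw [fibre_singleton_leaf hf hleaf h3o a₁ a₂,
    prob_inter_closedEdge_of_free p (free_Q hf hleaf h3o h31 h32)]

/-- `Ssig_x {a₃} = (1 − q) (P(Q, x ∈ C₁) − P(Q, x ∈ C₂))` for a mark `x ≠ a₃`. -/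
lemma Ssig_singleton_leaf (hf : ends f = s(a₃, o)) (hleaf : ∀ e, a₃ ∈ ends e → e = f)
    (h3o : a₃ ≠ o) {a₁ a₂ : V} (h31 : a₃ ≠ a₁) (h32 : a₃ ≠ a₂) {x : V} (hx : x ≠ a₃) :
    Ssig p ends a₁ a₂ a₃ x {a₃} =
      (prob p (avoidAll ends a₂ {a₁} ∩ connEvent ends a₁ x) -
        prob p (avoidAll ends a₂ {a₁} ∩ connEvent ends a₂ x)) * (1 - p f) := by
  unfold Ssig
  rw [fibre_singleton_leaf hf hleaf h3o a₁ a₂]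
  have e1 : avoidAll ends a₂ {a₁} ∩ closedEdge f ∩ connEvent ends a₁ x =
      avoidAll ends a₂ {a₁} ∩ connEvent ends a₁ x ∩ closedEdge f := by
    ext ω; simp only [Set.mem_inter_iff]; tauto
  have e2 : avoidAll ends a₂ {a₁} ∩ closedEdge f ∩ connEvent ends a₂ x =
      avoidAll ends a₂ {a₁} ∩ connEvent ends a₂ x ∩ closedEdge f := by
    ext ω; simp only [Set.mem_inter_iff]; tauto
  rw [e1, e2, prob_inter_closedEdge_of_free p
      ((free_Q hf hleaf h3o h31 h32).inter (free_connEvent hf hleaf h3o (Ne.symm h31) hx)),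
    prob_inter_closedEdge_of_free p
      ((free_Q hf hleaf h3o h31 h32).inter (free_connEvent hf hleaf h3o (Ne.symm h32) hx))]
  ring

/-- `Su_x {a₃} = (1 − q) (P(Q, x ∈ C₁) + P(Q, x ∈ C₂))` for a mark `x ≠ a₃`. -/
lemma Su_singleton_leaf (hf : ends f = s(a₃, o)) (hleaf : ∀ e, a₃ ∈ ends e → e = f)
    (h3o : a₃ ≠ o) {a₁ a₂ : V} (h31 : a₃ ≠ a₁) (h32 : a₃ ≠ a₂) {x : V} (hx : x ≠ a₃) :
    Su p ends a₁ a₂ a₃ x {a₃} =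
      (prob p (avoidAll ends a₂ {a₁} ∩ connEvent ends a₁ x) +
        prob p (avoidAll ends a₂ {a₁} ∩ connEvent ends a₂ x)) * (1 - p f) := by
  unfold Su
  rw [fibre_singleton_leaf hf hleaf h3o a₁ a₂]
  have e1 : avoidAll ends a₂ {a₁} ∩ closedEdge f ∩ connEvent ends a₁ x =
      avoidAll ends a₂ {a₁} ∩ connEvent ends a₁ x ∩ closedEdge f := by
    ext ω; simp only [Set.mem_inter_iff]; tauto
  have e2 : avoidAll ends a₂ {a₁} ∩ closedEdge f ∩ connEvent ends a₂ x =
      avoidAll ends a₂ {a₁} ∩ connEvent ends a₂ x ∩ closedEdge f := by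
    ext ω; simp only [Set.mem_inter_iff]; tauto
  rw [e1, e2, prob_inter_closedEdge_of_free p
      ((free_Q hf hleaf h3o h31 h32).inter (free_connEvent hf hleaf h3o (Ne.symm h31) hx)),
    prob_inter_closedEdge_of_free p
      ((free_Q hf hleaf h3o h31 h32).inter (free_connEvent hf hleaf h3o (Ne.symm h32) hx))]
  ring

/-- `E_Q[σ_b σ₃] = q · E_Q[σ_b σ_o]` at a leaf `a₃` at `o`. -/
lemma EQb3_leaf (hf : ends f = s(a₃, o)) (hleaf : ∀ e, a₃ ∈ ends e → e = f) (h3o : a₃ ≠ o)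
    {a₁ a₂ : V} (h31 : a₃ ≠ a₁) (h32 : a₃ ≠ a₂) {b : V} (hb : b ≠ a₃) :
    EQb3 p ends a₁ a₂ a₃ b = p f * EQbo p ends o a₁ a₂ b := by
  have c₁b := free_connEvent hf hleaf h3o (Ne.symm h31) hb
  have c₂b := free_connEvent hf hleaf h3o (Ne.symm h32) hb
  unfold EQb3 EQbo
  rw [prob_T'_inter_o p hf hleaf h3o h31 h32 c₁b, prob_T_inter_o p hf hleaf h3o h31 h32 c₂b,
    prob_T_inter_o p hf hleaf h3o h31 h32 c₁b, prob_T'_inter_o p hf hleaf h3o h31 h32 c₂b]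
  ring

/-- `E_Q[σ₃] = q · E_Q[σ_o]` at a leaf `a₃` at `o`. -/
lemma EQ3_leaf (hf : ends f = s(a₃, o)) (hleaf : ∀ e, a₃ ∈ ends e → e = f) (h3o : a₃ ≠ o)
    {a₁ a₂ : V} (h31 : a₃ ≠ a₁) (h32 : a₃ ≠ a₂) :
    EQ3 p ends a₁ a₂ a₃ = p f * EQo p ends o a₁ a₂ := by
  unfold EQ3 EQo
  rw [prob_T'_o p hf hleaf h3o h31 h32, prob_T_o p hf hleaf h3o h31 h32]
  ring

/-- `E_Q[σ₃ U_o] = q · E_Q[σ_o]` at a leaf `a₃` at `o` (`σ₃ ≠ 0` forces `o ∈ U`). -/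
lemma EQ3o_leaf (hf : ends f = s(a₃, o)) (hleaf : ∀ e, a₃ ∈ ends e → e = f) (h3o : a₃ ≠ o)
    {a₁ a₂ : V} (h31 : a₃ ≠ a₁) (h32 : a₃ ≠ a₂) :
    EQ3o p ends o a₁ a₂ a₃ = p f * EQo p ends o a₁ a₂ := by
  have c₁o := free_connEvent hf hleaf h3o (Ne.symm h31) (Ne.symm h3o)
  have c₂o := free_connEvent hf hleaf h3o (Ne.symm h32) (Ne.symm h3o)
  unfold EQ3o EQo
  rw [prob_T'_inter_o p hf hleaf h3o h31 h32 c₁o, prob_T'_inter_o p hf hleaf h3o h31 h32 c₂o,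
    prob_T_inter_o p hf hleaf h3o h31 h32 c₁o, prob_T_inter_o p hf hleaf h3o h31 h32 c₂o,
    Set.inter_self, Set.inter_self, Q_inter_both_eq_empty₂ ends a₁ a₂ o,
    Q_inter_both_eq_empty₂' ends a₁ a₂ o, prob_empty]
  ring

/-- `D_o = (1 − q) P(Q, o ∈ U)` at a leaf `a₃` at `o`. -/
lemma Do_leaf (hf : ends f = s(a₃, o)) (hleaf : ∀ e, a₃ ∈ ends e → e = f) (h3o : a₃ ≠ o)
    {a₁ a₂ : V} (h31 : a₃ ≠ a₁) (h32 : a₃ ≠ a₂) :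
    Do p ends o a₁ a₂ a₃ =
      (prob p (avoidAll ends a₂ {a₁} ∩ connEvent ends a₁ o) +
        prob p (avoidAll ends a₂ {a₁} ∩ connEvent ends a₂ o)) * (1 - p f) := by
  have c₁o := free_connEvent hf hleaf h3o (Ne.symm h31) (Ne.symm h3o)
  have c₂o := free_connEvent hf hleaf h3o (Ne.symm h32) (Ne.symm h3o)
  unfold Do
  rw [prob_PD_inter_o p hf hleaf h3o h31 h32 c₁o, prob_PD_inter_o p hf hleaf h3o h31 h32 c₂o,
    Set.inter_self, Set.inter_self, Q_inter_both_eq_empty₂ ends a₁ a₂ o,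
    Q_inter_both_eq_empty₂' ends a₁ a₂ o, prob_empty]
  ring

/-- `P(PD, b ∈ U) = m_b − q · P(Q, o ∈ U, b ∈ U)` at a leaf `a₃` at `o`. -/
lemma PDb_leaf (hf : ends f = s(a₃, o)) (hleaf : ∀ e, a₃ ∈ ends e → e = f) (h3o : a₃ ≠ o)
    {a₁ a₂ : V} (h31 : a₃ ≠ a₁) (h32 : a₃ ≠ a₂) {b : V} (hb : b ≠ a₃) :
    PDb p ends a₁ a₂ a₃ b =
      LeafStep.mU p ends a₁ a₂ b - p f * LeafStep.mUU p ends o a₁ a₂ b := by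
  have c₁b := free_connEvent hf hleaf h3o (Ne.symm h31) hb
  have c₂b := free_connEvent hf hleaf h3o (Ne.symm h32) hb
  unfold PDb LeafStep.mU LeafStep.mUU
  rw [prob_PD_inter_o p hf hleaf h3o h31 h32 c₁b, prob_PD_inter_o p hf hleaf h3o h31 h32 c₂b]
  ring

end LeafMasses

section LeafMassesV

variable {V : Type*} {E : Type*} [DecidableEq V] [Fintype E] [DecidableEq E] {R : Type*} [Field R]
  {ends : E → Sym2 V} {a₃ o : V} (p : E → R)

/-- `SF {a₃} = Ssig_o {a₃}` (the world sign of `{a₃}` is `0`). -/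
lemma SF_singleton_leaf {a₁ a₂ : V} (h31 : a₃ ≠ a₁) (h32 : a₃ ≠ a₂) :
    SF p ends o a₁ a₂ a₃ {a₃} = Ssig p ends a₁ a₂ a₃ o {a₃} := by
  unfold SF
  rw [s3_singleton (R := R) a₁ a₂ h31 h32]
  ring

end LeafMassesV


end A3Fibre

end CovForm

end Summit.Ventures.PercRepro2
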